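import Summits.QuantumAdvantage.QuantumAdvantage.Theorems.WbwObfuscatedGluedTreesKowPhVocabulary

/-!
# `WbwObfuscatedGluedTrees` (stmt-QuantumAdvantage-2340) — line `knowledge-of-walk-split`, STAGE 7: the two simulator
# programs of the PRF hybrid (layer B: primitives over table lookups; layer C: walk requests over layer B)

Definitions file (companion of `KowPhVocabulary`; no hardness asserted, no theorem content): the adaptive
straight-line PROGRAMS (`runProg`, `adFnAlgL` of the vocabulary) by which one probabilistic polynomial-time oracle
machine, given oracle access to the four tables (the PRF oracle of the scheduled product ensemble, or a uniformly
random function), plays the black-box walk game against a walker exactly as the request oracle of the ideal-II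
instance `(codeCycle T d, codeNaming T d)` of the tables `T = tabOf μ O` would:

* §4 LAYER B (cryptographic primitives over table lookups): the request codes, the program `primQ` / `primOut`
  (SIV encryption of a label: 2 lookups; recognition of a name: 2 lookups; one keyed Feistel permutation or its
  inverse: 4 lookups) and its specification `primSpec μ d T` (the generator's own `sivEnc`, `unname`, `prp` over the
  table scheme `tabScheme T`);
* §5 LAYER C (the walk requests over layer B): the program `walkQ Λ` / `walkOut Λ` (recognise the queried name, read
  the leaf's cycle atom by three permutation calls, name the `≤ 3` neighbours, sort, assemble the answer string, read
  one bit) and its specification `reqSpec σ ν`.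

Semantics (`runProg primQ primOut 4 O = primSpec μ d (tabOf μ O)`, `runProg walkQ walkOut 7 O' = reqSpec …`) and
polynomial time (`CodeFP` of the four maps) are the registered stubs of stage 7, proved in their own files.

[folklore] modelling conventions of the route; objects: ChildsEtAl2003 §2 / §4 Game 1, LubyRackoff1988 (Feistel
rounds), Goldreich2004FoC2 Constructions 5.3.9 / 5.4.19 (SIV naming), LadnerLynchSelman1975 §3 (transducers).
-/

set_option linter.dupNamespace false

noncomputable section

namespace Summit.QuantumAdvantage.QuantumAdvantage.Theorems.WbwObfuscatedGluedTrees.KnowledgeOfWalk.PrfHybrid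

open Literature.Computability.Complexity Literature.Computability.QuantumComplexity
open Literature.Computability.QuantumComplexity.GluedTrees
open Literature.Computability.Cryptography Literature.Computability.Cryptography.ObfuscatedGluedTrees
open Summit.QuantumAdvantage.QuantumAdvantage.Theorems.WbwObfuscatedGluedTrees.KnowledgeOfWalk.BlackBox
open Summit.QuantumAdvantage.QuantumAdvantage.Theorems.WbwObfuscatedGluedTrees.KnowledgeOfWalk.RealIdeal
open _root_.Computability

/-! ## §4 Layer B: SIV encryption, name recognition and the keyed Feistel permutations over table lookups -/

section LayerB

/-- The data code of layer B: `((μ, d), body) ↦ ⟨⟨1^μ, 1^d⟩, body⟩`. [folklore] -/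
def codeB (a : (ℕ × ℕ) × List Bool) : List Bool :=
  boolPair (boolPair (unaryEncodeNat a.1.1) (unaryEncodeNat a.1.2)) a.2

/-- A well-formed dummy lookup (table `0` at `0^μ`; its answer is ignored). [folklore] -/
def dummyLookup (μ : ℕ) : List Bool := tkey 0 ++ List.replicate μ false

/-- The lower-half mask `1^{⌊d/2⌋} 0^{⌈d/2⌉}` (`List.ofFn (lowHalf d)`). [cite: LubyRackoff1988, main construction] -/
def maskLow (d : ℕ) : List Bool := List.replicate (d / 2) true ++ List.replicate (d - d / 2) false

/-- The upper-half mask `0^{⌊d/2⌋} 1^{⌈d/2⌉}` (`List.ofFn (highHalf d)`). [cite: LubyRackoff1988, main construction] -/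
def maskHigh (d : ℕ) : List Bool := List.replicate (d / 2) false ++ List.replicate (d - d / 2) true

/-- The round schedule of the permutation program: step `s` of the FORWARD evaluation is Feistel round `s` with mask
`L, H, L, H`; step `s` of the INVERSE evaluation is round `3 − s` with mask `H, L, H, L` (every round is an
involution, so the inverse is the rounds in reverse order). [cite: LubyRackoff1988, main construction] -/
def prpRound (d : ℕ) (inv : Bool) (s : ℕ) : ℕ × List Bool :=
  if inv then (3 - s, if s % 2 = 0 then maskHigh d else maskLow d)
  else (s, if s % 2 = 0 then maskLow d else maskHigh d)

/-- The Feistel state after the round answers `as` (from step `s` on): each answer `a` is the table value at the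
round's lookup, its `d`-bit fitting is the round function's value, and the masked positions are xored with it
(`W ↦ W ⊕ (M ∧ fit d (fit μ a))`). [cite: LubyRackoff1988, main construction] -/
def prpFold (μ d : ℕ) (inv : Bool) : List Bool → ℕ → List (List Bool) → List Bool
  | W, _, [] => W
  | W, s, a :: as =>
    prpFold μ d inv (ObfuscatedGluedTrees.bxor W (List.zipWith (fun m b => m && b) (prpRound d inv s).2 (fit d (fit μ a)))) (s + 1) as

/-- The lookup of Feistel step `s` at state `W` on table `it`: `tkey it ++ fit μ (⟨r⟩₈ ++ (¬M ∧ W))` (the round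
function `F_r(y) = F(⟨r⟩₈ ++ y)` at the blanked vector). [cite: LubyRackoff1988, main construction] -/
def prpLookup (μ d : ℕ) (inv : Bool) (it : Fin 4) (s : ℕ) (W : List Bool) : List Bool :=
  tkey it ++ fit μ (bitsOf 8 (prpRound d inv s).1 ++ List.zipWith (fun m b => !m && b) (prpRound d inv s).2 W)

/-- The Boolean label test: `x` is the label of some vertex of `G'_d` iff it has length `2d + 3`, its depth field is
`≤ d` and its position field is `< 2^{depth}`. [folklore] -/
def isLabelB (d : ℕ) (x : List Bool) : Bool :=
  decide (x.length = labelLen d) && decide (bitsToNat ((x.drop 1).take (d + 1)) ≤ d) &&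
    decide (bitsToNat ((x.drop (d + 2)).take (d + 1)) < 2 ^ bitsToNat ((x.drop 1).take (d + 1)))

/-- **The query map of layer B.**  Request bodies: `0 0 ℓ` = ENCRYPT the label `ℓ` (lookup 0: the tag `T₀(fit μ ℓ)`;
lookup 1: the mask `T₁(tag)`); `0 1 y` = RECOGNISE the name `y` (lookup 0: the mask `T₁(y ↾ μ)`; lookup 1: the tag
`T₀` of the unmasked candidate label); `1 inv tb w` = the keyed Feistel PERMUTATION of table `2 + tb` (or its inverse)
at the `d`-bit vector `fit d w` (lookups 0–3: the four rounds); anything else, and every step past the meaningful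
ones, a dummy lookup. [cite: Goldreich2004FoC2, Constructions 5.3.9 and 5.4.19] -/
def primQ (μ d : ℕ) (body : List Bool) (as : List (List Bool)) : List Bool :=
  match body with
  | false :: false :: ℓ =>
    if as.length = 0 then tkey 0 ++ fit μ ℓ
    else if as.length = 1 then tkey 1 ++ fit μ (as.getD 0 [])
    else dummyLookup μ
  | false :: true :: y =>
    if as.length = 0 then tkey 1 ++ fit μ (y.take μ)
    else if as.length = 1 then
      tkey 0 ++ fit μ (ObfuscatedGluedTrees.bxor (y.drop μ) (fit (y.length - μ) (fit μ (as.getD 0 []))))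
    else dummyLookup μ
  | true :: inv :: tb :: w =>
    prpLookup μ d inv (if tb then 3 else 2) as.length (prpFold μ d inv (fit d w) 0 as)
  | _ => dummyLookup μ

/-- **The output map of layer B** (after four lookups): ENCRYPT ↦ `tag ++ (ℓ ⊕ mask)`; RECOGNISE ↦ `1·x` for the
candidate label `x` if `y` has the length of a name, its tag recomputes and `x` is a label, `[]` otherwise (ONE
rejection symbol); PERMUTATION ↦ the final Feistel state. [cite: Goldreich2004FoC2, Constructions 5.3.9 and 5.4.19] -/
def primOut (μ d : ℕ) (body : List Bool) (as : List (List Bool)) : List Bool :=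
  match body with
  | false :: false :: ℓ => fit μ (as.getD 0 []) ++ ObfuscatedGluedTrees.bxor ℓ (fit ℓ.length (fit μ (as.getD 1 [])))
  | false :: true :: y =>
    let x := ObfuscatedGluedTrees.bxor (y.drop μ) (fit (y.length - μ) (fit μ (as.getD 0 [])))
    if y.length = μ + labelLen d ∧ fit μ (as.getD 1 []) = y.take μ ∧ isLabelB d x = true then true :: x else []
  | true :: inv :: _ :: w => prpFold μ d inv (fit d w) 0 as
  | _ => []

/-- **The specification of layer B**: the generator's OWN primitives over the table scheme of `T` — SIV encryption
`sivEnc`, name recognition `unname` (reported as `1·label v`, or `[]`), and the keyed permutation `prp` of table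
`2 + tb` (or its inverse) at `fit d w`, listed. [cite: Goldreich2004FoC2, Constructions 5.3.9 and 5.4.19] -/
def primSpec (μ d : ℕ) (T : CodeSpace μ) (body : List Bool) : List Bool :=
  match body with
  | false :: false :: ℓ => sivEnc (tabScheme T) μ (tkey 0) (tkey 1) ℓ
  | false :: true :: y => ((unname (tabScheme T) μ (tkey 0) (tkey 1) d y).map fun v => true :: label d v).getD []
  | true :: inv :: tb :: w =>
    let π := prp (tabScheme T) μ (tkey (if tb then 3 else 2)) d
    List.ofFn ((if inv then π.symm else π) (vecOf d w))
  | _ => []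

end LayerB

/-! ## §5 Layer C: the walk requests over layer B -/

section LayerC

variable (Λ : Params)

/-- The data code of layer C: `(n, req) ↦ ⟨1ⁿ, req⟩`. [folklore] -/
def codeC (a : ℕ × List Bool) : List Bool := boolPair (unaryEncodeNat a.1) a.2

/-- A layer-B request from layer C at seed length `n`: `⟨⟨1^μ, 1^d⟩, body⟩` at the generator's schedules
`μ = Λ.prfParam n`, `d = Λ.depth n`. [folklore] -/
def mkReq (n : ℕ) (body : List Bool) : List Bool :=
  codeB ((Λ.prfParam n, Λ.depth n), body)

/-- The label with side `s`, depth field `j` and position field `i` (`= label d (s, j, i)` for a vertex). [cite: ChildsEtAl2003, §2] -/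
def mkLabel (d : ℕ) (s : Bool) (j i : ℕ) : List Bool := s :: (bitsOf (d + 1) j ++ bitsOf (d + 1) i)

/-- The depth field of a label. [folklore] -/
def labDepth (d : ℕ) (x : List Bool) : ℕ := bitsToNat ((x.drop 1).take (d + 1))

/-- The position field of a label. [folklore] -/
def labIdx (d : ℕ) (x : List Bool) : ℕ := bitsToNat ((x.drop (d + 2)).take (d + 1))

/-- The three PERMUTATION request bodies reading the cycle atom of the leaf with side `s` and position `i`, given the
answer `p₁` to the first of them: left leaf `i`: `k = e⁻¹ i` (inverse, table 2), `f k`, `f (k − 1)` (forward, table 3);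
right leaf `i`: `k = f⁻¹ i` (inverse, table 3), `e k`, `e (k + 1)` (forward, table 2) — the cross neighbours
`crossR`/`crossL` of the leaf. [cite: ChildsEtAl2003, §2] -/
def prpBodies (d : ℕ) (s : Bool) (i : ℕ) (p₁ : List Bool) : List (List Bool) :=
  if s then
    [true :: true :: true :: bitsOf d i, true :: false :: false :: p₁,
      true :: false :: false :: bitsOf d ((bitsToNat p₁ + 1) % 2 ^ d)]
  else
    [true :: true :: false :: bitsOf d i, true :: false :: true :: p₁,
      true :: false :: true :: bitsOf d ((bitsToNat p₁ + 2 ^ d - 1) % 2 ^ d)]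

/-- The labels of the neighbours of the vertex with label `x`, given the answers `p₂ p₃` to the second and third
permutation requests (the two cross positions, used only at a leaf): the parent (unless a root), then the two children
(inner vertex) or the two cross leaves on the other side (leaf). [cite: ChildsEtAl2003, §2] -/
def nbrLabels (d : ℕ) (x p₂ p₃ : List Bool) : List (List Bool) :=
  let s := x.headD false
  let j := labDepth d x
  let i := labIdx d x
  (if j = 0 then [] else [mkLabel d s (j - 1) (i / 2)]) ++
    (if j = d then [mkLabel d (!s) d (bitsToNat p₂), mkLabel d (!s) d (bitsToNat p₃)]
      else [mkLabel d s (j + 1) (2 * i), mkLabel d s (j + 1) (2 * i + 1)])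

/-- Insertion of a name into a list sorted by binary value. [folklore] -/
def insertByVal (u : List Bool) : List (List Bool) → List (List Bool)
  | [] => [u]
  | v :: vs => if bitsToNat u ≤ bitsToNat v then u :: v :: vs else v :: insertByVal u vs

/-- Sorting a list of names by increasing binary value (insertion sort). [folklore] -/
def sortByVal : List (List Bool) → List (List Bool)
  | [] => []
  | u :: us => insertByVal u (sortByVal us)

/-- **The query map of layer C** (seven layer-B requests per walk request).  `1·_` (the lead's private request) and
`0 1 _` (the walker's ENTRANCE request): encrypt the label of the EXIT, resp. the ENTRANCE; `0 0 q` with `|q| = 2N`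
(a bit query about the name `a = q ↾ N`): recognise `a` (request 0), read the cycle atom of the named leaf by three
permutation requests (1–3; dummies at an inner vertex or an invalid name), encrypt the labels of the `≤ 3` neighbours
(4–6); every other request is answered without meaningful lookups. [cite: ChildsEtAl2003, §2 and §4 Game 1] -/
def walkQ (a : ℕ × List Bool) (as : List (List Bool)) : List Bool :=
  let n := a.1
  let μ := Λ.prfParam n
  let d := Λ.depth n
  let N := nameLen μ d
  match a.2 with
  | true :: _ => if as.length = 0 then mkReq Λ n (false :: false :: mkLabel d true 0 0) else mkReq Λ n []
  | false :: true :: _ => if as.length = 0 then mkReq Λ n (false :: false :: mkLabel d false 0 0) else mkReq Λ n []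
  | false :: false :: q =>
    if q.length = N + N then
      let r₀ := as.getD 0 []
      let x := r₀.tail
      if as.length = 0 then mkReq Λ n (false :: true :: q.take N)
      else if r₀.headD false = false then mkReq Λ n []
      else if as.length ≤ 3 then
        (if labDepth d x = d then
          mkReq Λ n ((prpBodies d (x.headD false) (labIdx d x) (as.getD 1 [])).getD (as.length - 1) [])
        else mkReq Λ n [])
      else
        let L := nbrLabels d x (as.getD 2 []) (as.getD 3 [])
        if as.length - 4 < L.length then mkReq Λ n (false :: false :: L.getD (as.length - 4) []) else mkReq Λ n []
    else mkReq Λ n []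
  | _ => mkReq Λ n []

/-- **The output map of layer C**: the exit / entrance name is the answer to request 0; for a bit query about a valid
name, the names answered to requests `4, 5, 6` (as many as there are neighbours), sorted by binary value, give the
answer string `fit (3N + 2) (⟨#nbrs⟩₂ ++ names)` of which bit `val(q ⇂ N)` is returned; an invalid name gets the bit
`0` of the all-invalid answer; ill-formed requests get `[]`. [cite: ChildsEtAl2003, §2 and §4 Game 1] -/
def walkOut (a : ℕ × List Bool) (as : List (List Bool)) : List Bool :=
  let n := a.1
  let μ := Λ.prfParam n
  let d := Λ.depth n
  let N := nameLen μ d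
  match a.2 with
  | true :: _ => as.getD 0 []
  | false :: true :: _ => as.getD 0 []
  | false :: false :: q =>
    if q.length = N + N then
      let r₀ := as.getD 0 []
      let x := r₀.tail
      if r₀.headD false = false then [false]
      else
        let L := nbrLabels d x (as.getD 2 []) (as.getD 3 [])
        let names := (List.range L.length).map fun t => as.getD (4 + t) []
        let R := sortByVal names
        [(fit (ansLen N) (bitsOf 2 R.length ++ R.flatten)).getD (bitsToNat (q.drop N)) false]
    else []
  | _ => []

variable {d N : ℕ}

/-- **The specification of layer C**: the lead's private request `1·_` is answered by `name(EXIT)`, a forwarded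
walker request `0·u` by the request oracle of the instance. [cite: ChildsEtAl2003, §2 and §4 Game 1] -/
def reqSpec (σ : CycleDatum d) (ν : NamingN d N) : Oracle
  | true :: _ => List.ofFn (ν (GluedTrees.exit d))
  | false :: u => walkOracle σ ν u
  | [] => []

end LayerC

/-- Registered helper stub of crux stmt-QuantumAdvantage-2340 (the gate admits a `--supports` file only if it proves
a registered stub): the specification of layer C forwards walker requests to the request oracle. [folklore] -/
theorem toolkit_phPrograms :
    ∀ {d N : ℕ} (σ : CycleDatum d) (ν : NamingN d N) (u : List Bool), reqSpec σ ν (false :: u) = walkOracle σ ν u :=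
  fun _ _ _ => rfl

end Summit.QuantumAdvantage.QuantumAdvantage.Theorems.WbwObfuscatedGluedTrees.KnowledgeOfWalk.PrfHybrid

end
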